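import Summits.BirchSwinnertonDyer.BirchSwinnertonDyer.Theses.KatoDescentTamePotSupersingular
import Summits.BirchSwinnertonDyer.BirchSwinnertonDyer.Theorems.KatoDescentPotSupersingularMuCoreIrrConjAOdd
import HarnessLib

/-!
# K8-t′ crux `TameCoatesSujathaResidue` (item stmt-BirchSwinnertonDyer-19916, the Conj-A residue of the TAME U₀-ns node)
# BY NAME from ONE analytic hypothesis: «on every `E[p]`-irreducible curve with `p`-adic tower not onto (`p` odd)
# some genuine Λ-adic Euler-system class lies outside `p·𝐇¹_Γ(T_pW)`» — CONDITIONAL closer (item stays open)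

Seat `bsd-potss-k9-c4` g14 (prover; cell `bsd-potss`; courtesy for the KT lane); `--supports stmt-BirchSwinnertonDyer-19916
--as helper`; closes nothing (conditional-result).  HONEST FRAMING: BSD is not proved by any of this; Conjecture A is
NOT proved; nothing is booked.  KT twin of `…KatoDescentPotSupersingularWildCoatesSujathaResidueOfEulerClassIndivisible`
(p589216): the tame Conj-A residue crux follows — its row conditions (rank `0`, `Addv`, `SubTprime`, optimal member)
unused — from the displayed hypothesis, by `MuCoreIrr.exists_fineSelmerDualData_moduleFinite_of_irr_of_not_towerSurj_of_eulerClass`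
(p ≥ 5: K6 μ-core with its own image facts; p = 3: the μ-core under `E[3]` irreducible alone, k9-c4 g14).

References: [CoatesSujatha2005] Conjecture A; [Kato2004Asterisque] §13.8; [Serre1972] §2.4–2.6;
HOME pub/bsd-smallim/koly/MU-TRANSFER-PROOF.md.
-/

-- the summit and its single problem are both named `BirchSwinnertonDyer` (registry layout D-0017)
set_option linter.dupNamespace false
set_option autoImplicit false

noncomputable section

open Field WeierstrassCurve
open Literature.NumberTheory.GaloisRepresentations Literature.NumberTheory.EllipticCurves
open Literature.NumberTheory.EllipticCurves.Kato2004 Literature.NumberTheory.EllipticCurves.Kato2004.EulerSystemValues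

namespace Summit.BirchSwinnertonDyer.BirchSwinnertonDyer.Theorems

/-- **`TameCoatesSujathaResidue` (item 19916) from the `p`-indivisibility of a genuine Euler-system class**, by name:
CONDITIONAL closer; only `p ≠ 2`, `E[p]` irreducible and «tower not onto» of the route decl are used.
[cite: CoatesSujatha2005, §3 and Conjecture A] [cite: Kato2004Asterisque, §13.8 (pp. 228–229)]
[cite: Serre1972, §2.4 Prop. 15, §2.5–2.6] -/
theorem tameCoatesSujathaResidue_of_eulerClassIndivisible
    (hZ : ∀ (W : WeierstrassCurve ℚ) [W.IsElliptic] [W.IsGloballyMinimal] (p : ℕ) [Fact p.Prime],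
      p ≠ 2 → W.HasIrreducibleModPGaloisRep p → ¬ (∀ n : ℕ, W.HasSurjectiveModNGaloisRep (p ^ n : ℕ)) →
      ¬ W.HasCM → ∀ (κ : ZpExtension ℚ p), κ.IsCyclotomic →
        letI : ContinuousSMul ℤ_[p] (W.tateModule p) := TateModule.continuousSMul_padicInt
        haveI : Module.Free ℤ_[p] (W.tateModule p) := W.module_free_tateModule_holds p
        haveI : Module.Finite ℤ_[p] (W.tateModule p) := W.module_finite_tateModule_holds p
        ∀ (γ : absoluteGaloisGroup ℚ) (I : IwasawaH1Data W p κ γ), κ.IsTopGenerator γ →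
          ∃ s : I.H, IsEulerSystemClass W p κ γ I s ∧
            s ∉ IwasawaAlgebra.augIdealP p • (⊤ : Submodule (IwasawaAlgebra p) I.H)) :
    Summit.BirchSwinnertonDyer.BirchSwinnertonDyer.Theses.KatoDescentTamePotSupersingular.TameCoatesSujathaResidue := by
  intro W _ _ p _ _hr hp2 _hadd _hsub hCM hirr hnt _hopt κ hκ
  exact MuCoreIrr.exists_fineSelmerDualData_moduleFinite_of_irr_of_not_towerSurj_of_eulerClass W p hp2 hirr hnt κ hκ
    (hZ W p hp2 hirr hnt hCM κ hκ)

end Summit.BirchSwinnertonDyer.BirchSwinnertonDyer.Theorems
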